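import Summits.BirchSwinnertonDyer.BirchSwinnertonDyer.Theorems.ByReductionTypeAtTwoAdditiveRankZeroResidualGlueS3
import Summits.BirchSwinnertonDyer.BirchSwinnertonDyer.Theorems.ByReductionTypeAtTwoAdditiveReducibleKatoMember
import HarnessLib

/-!
# Crux `AdditiveRankZeroAtTwo` (K4 item 19098) BY NAME from its residual — v3: the `E[2]`-REDUCIBLE upper half (I2)
# split by Kato's member bound at `2` (`Kato2004.exists_memberHullInputs_two`) into the classes with small `2`-torsion
# and even `ord₂ #Ш_an` (now PRINT + one named transcription) and the rest (displayed)

Seat `bsd-2adic-addL2x` GEN 10 (cell `bsd-2adic`, rung K4, crux stmt-BirchSwinnertonDyer-19098, line add_twist_overK v2).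
`--supports 19098 --as helper`. The kernel glue `additiveRankZeroAtTwo_of_residual_S3` (GEN 9, p621854) takes the
`E[2]`-reducible upper half `hUred` («`¬CM → r_an = 0 → DefectAtLeastThree → ¬ irreducible → MissingUpperBoundAt W 2`»,
210 census classes) as ONE displayed hypothesis. This file feeds it from
`AddKatoTwo.addBlock_reducibleUpper_two_of_smallTorsion` (Kato's member bound at `2` through the named fact
`exists_memberHullInputs_two` + Cassels + Cassels–Tate + GZK + modularity + Lim@2 + Ferrero–Washington BY NAME) on the
curves whose isogeny class has `2`-primary torsion of order `2` on every member and whose `ord₂ #Ш_an` is even, and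
displays the complement `hUredRest` (a class with a point of order `4` or full rational `2`-torsion on some member, or
odd `ord₂ #Ш_an`). HONEST FRAMING: closes nothing at the `∀`-level; `exists_memberHullInputs_two` is a READING
(statement-only lane, D-audit owed); BSD is not proved by any of this. The `∀`-residual of 19098 after this file:
PRINT {GZK, modularity ×2, Milne any-model, Hoffstein–Luo, Murty–Murty, Lim@2, FW, Cassels, Cassels–Tate} + READINGS
{hSharp, exists_memberHullInputs_two} + siblings {19095, 19096, 19097} + (I1′) (A)@2 on the S₃-image sub-block + (I2b)
`hUredRest` + (I3) hKC + (I4) stub_addQuadraticOverK.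

References: [Kato2004Asterisque] Thm. 12.4–12.6, §14.14, Prop. 14.16 (2); [Cassels1965ArithmeticVIII]; [MilneADT2006]
I.7.3; [SilvermanAEC2009] X.4.14; [Lim2017FineSelmer] Thm. 3.5; [FerreroWashington1979]; [Miller2011LMS] Def. 1.1.
-/

set_option autoImplicit false
set_option linter.dupNamespace false

noncomputable section

open scoped Classical

namespace Summit.BirchSwinnertonDyer.BirchSwinnertonDyer.Theorems.AddKatoTwo

open WeierstrassCurve Literature.NumberTheory.EllipticCurves
  Literature.NumberTheory.EllipticCurves.ModularForms
  Literature.NumberTheory.EllipticCurves.Kato2004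
  Literature.NumberTheory.EllipticCurves.Rank1Residual
  Literature.NumberTheory.EllipticCurves.Rank1Residual.Typed
  Literature.NumberTheory.IwasawaTheory
  Summit.BirchSwinnertonDyer.Rank1Residual Summit.BirchSwinnertonDyer.Rank1Residual.AdditivePotMult
  Summit.BirchSwinnertonDyer.Rank1Residual.X5.AddTwoL2
  Summit.BirchSwinnertonDyer.BirchSwinnertonDyer.Theses.ByReductionTypeAtTwo

/-- **The `E[2]`-reducible upper half (I2) from Kato's member bound at `2` on the small-torsion / even-`Ш_an` classes
and a displayed remainder.** `hUred` of `additiveRankZeroAtTwo_of_residual{,_S3}` follows from the named facts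
(`hmodN`, `hin`, `hLim2`, `hFW`, `hCassels`, `hCT`, `hGZK`, `hmod`) on the curves satisfying the two side conditions
(`addBlock_reducibleUpper_two_of_smallTorsion`) and from the displayed `hUredRest` on the others. Bookkeeping (`by_cases`).
[cite: Kato2004Asterisque, Prop. 14.16 (2) (p. 244)] [cite: Cassels1965ArithmeticVIII] [cite: SilvermanAEC2009, Thm. X.4.14] -/
theorem addBlock_reducibleUpper_two_of_smallTorsion_of_rest (hmodN : exists_isNewformOf)
    (hin : Kato2004.exists_memberHullInputs_two)
    (hLim2 : Lim2017.thm35_at_two_fineSelmerDual_moduleFinite_of_classicalMuVanishes_of_le_divisionField_four)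
    (hFW : ferreroWashington1979_classicalMuVanishes)
    (hCassels : bsdRHS_eq_of_isIsogenous) (hCT : exists_casselsTate_pairing (K := ℚ))
    (hGZK : rank_eq_analyticRank_of_analyticRank_le_one) (hmod : hasEntireLFunction_rat)
    (hUredRest : ∀ (W : WeierstrassCurve ℚ) [W.IsElliptic] [W.IsGloballyMinimal], ¬ W.HasCM → W.analyticRank = 0 →
      DefectAtLeastThree W → ¬ W.HasIrreducibleModPGaloisRep 2 →
      ¬ ((∀ (W' : WeierstrassCurve ℚ) [W'.IsElliptic], IsIsogenous W W' → ¬ 2 ^ 2 ∣ W'.torsionOrder) ∧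
          (∀ q : ℚ, shaAn W = (q : ℂ) → Even (padicValRat 2 q))) →
      MissingUpperBoundAt W 2) :
    ∀ (W : WeierstrassCurve ℚ) [W.IsElliptic] [W.IsGloballyMinimal], ¬ W.HasCM → W.analyticRank = 0 →
      DefectAtLeastThree W → ¬ W.HasIrreducibleModPGaloisRep 2 → MissingUpperBoundAt W 2 := by
  intro W _ _ hcm hr hdef hred
  by_cases hside : (∀ (W' : WeierstrassCurve ℚ) [W'.IsElliptic], IsIsogenous W W' → ¬ 2 ^ 2 ∣ W'.torsionOrder) ∧
      (∀ q : ℚ, shaAn W = (q : ℂ) → Even (padicValRat 2 q))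
  · exact addBlock_reducibleUpper_two_of_smallTorsion hmodN hin hLim2 hFW hCassels hCT hGZK hmod W hcm hr hdef hred
      (fun W' _ hiso => hside.1 W' hiso) hside.2
  · exact hUredRest W hcm hr hdef hred hside

/-- **The crux `AdditiveRankZeroAtTwo` (item stmt-BirchSwinnertonDyer-19098; type = the route decl verbatim) from its residual,
v3.** As `additiveRankZeroAtTwo_of_residual_S3` (GEN 9), with the `E[2]`-reducible upper half (I2) fed by Kato's member bound
at `2` — the named transcription `Kato2004.exists_memberHullInputs_two` (`hin`) with modularity-as-newform (`hmodN`), Cassels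
(`hCassels`), Cassels–Tate (`hCT`) BY NAME — on the classes with `2`-primary torsion of order `2` on every member and even
`ord₂ #Ш_an`, and by the displayed remainder `hUredRest` elsewhere. Inputs: PRINT {`hGZK`, `hmod`, `hmodN`, `hMilneC`, `hHL`,
`hMM`, `hLim2`, `hFW`, `hCassels`, `hCT`} + READINGS {`hSharp`, `hin`} + SIBLINGS {`hOrd`, `hMult`, `hSS`} + (I1′) `hAS3` +
(I2b) `hUredRest` + (I3) `hKC` + (I4) `hQK`. Conditional (audit `proof.conditional`); the item is NOT closed by this theorem.
[cite: Kato2004Asterisque, Thm. 12.6 (p. 222), §14.14 (p. 243), Prop. 14.16 (2) (p. 244)] [cite: Lim2017FineSelmer, §3 Thm. 3.5]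
[cite: Cassels1965ArithmeticVIII] [cite: SilvermanAEC2009, Thm. X.4.14] [cite: Miller2011LMS, Def. 1.1] -/
theorem additiveRankZeroAtTwo_of_residual_v3
    (hGZK : rank_eq_analyticRank_of_analyticRank_le_one) (hmod : hasEntireLFunction_rat) (hmodN : exists_isNewformOf)
    (hMilneC : Milne1972.bsdQuotient_baseChange_quadratic_anyModel)
    (hHL : HoffsteinLuo1997_exists_twist_L_one_ne_zero)
    (hMM : murtyMurty_exists_twist_ne_zero_prescribedAtTwo)
    (hLim2 : Lim2017.thm35_at_two_fineSelmerDual_moduleFinite_of_classicalMuVanishes_of_le_divisionField_four)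
    (hFW : ferreroWashington1979_classicalMuVanishes)
    (hCassels : bsdRHS_eq_of_isIsogenous) (hCT : exists_casselsTate_pairing (K := ℚ))
    (hSharp : Kato2004.rankZero_padicValNat_sha_add_padicValNat_tamagawa_le_at_two_of_irreducible_of_fineSelmerDual_fg)
    (hin : Kato2004.exists_memberHullInputs_two)
    (hOrd : GoodOrdinaryRankZeroAtTwo) (hMult : MultiplicativeRankZeroAtTwo) (hSS : SupersingularRankZeroAtTwo)
    (hAS3 : ∀ (W : WeierstrassCurve ℚ) [W.IsElliptic] [W.IsGloballyMinimal], ¬ W.HasCM → W.analyticRank = 0 →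
      DefectAtLeastThree W → ¬ IsAbelianGalois ℚ (W.divisionField 2) →
      ∀ (κ : ZpExtension ℚ 2), κ.IsCyclotomic →
        ∃ (γ : Field.absoluteGaloisGroup ℚ) (D : W.FineSelmerDualData κ γ),
          Module.Finite ℤ_[2] (RestrictScalars ℤ_[2] (IwasawaAlgebra 2) D.X))
    (hUredRest : ∀ (W : WeierstrassCurve ℚ) [W.IsElliptic] [W.IsGloballyMinimal], ¬ W.HasCM → W.analyticRank = 0 →
      DefectAtLeastThree W → ¬ W.HasIrreducibleModPGaloisRep 2 →
      ¬ ((∀ (W' : WeierstrassCurve ℚ) [W'.IsElliptic], IsIsogenous W W' → ¬ 2 ^ 2 ∣ W'.torsionOrder) ∧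
          (∀ q : ℚ, shaAn W = (q : ℂ) → Even (padicValRat 2 q))) →
      MissingUpperBoundAt W 2)
    (hKC : ∀ (W : WeierstrassCurve ℚ) [W.IsElliptic] [W.IsGloballyMinimal], ¬ W.HasCM → W.analyticRank = 0 →
      DefectAtLeastThree W → ∀ (K : Type) [Field K] [NumberField K], Module.finrank ℚ K = 2 → TwoInert K →
        (W.quadraticTwist (NumberField.discr K : ℚ)).entireLFunction 1 ≠ 0 →
          MissingPPartOverCAt (W.baseChange K) 2)
    (hQK : ∀ (W : WeierstrassCurve ℚ) [W.IsElliptic] [W.IsGloballyMinimal], ¬ W.HasCM → W.analyticRank = 0 →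
      Addv W 2 → ∀ (K : Type) [Field K] [NumberField K], Module.finrank ℚ K = 2 →
        SemistableTwistAtTwo W K → (W.quadraticTwist (NumberField.discr K : ℚ)).entireLFunction 1 ≠ 0 →
          MissingPPartOverCAt (W.baseChange K) 2) :
    Summit.BirchSwinnertonDyer.BirchSwinnertonDyer.Theses.ByReductionTypeAtTwo.AdditiveRankZeroAtTwo :=
  additiveRankZeroAtTwo_of_residual_S3 hGZK hmod hMilneC hHL hMM hLim2 hFW hSharp hOrd hMult hSS hAS3
    (addBlock_reducibleUpper_two_of_smallTorsion_of_rest hmodN hin hLim2 hFW hCassels hCT hGZK hmod hUredRest) hKC hQK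

end Summit.BirchSwinnertonDyer.BirchSwinnertonDyer.Theorems.AddKatoTwo

end
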